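import Summits.CriticalPhenomena.Ising3DConformalLimit.Theses.SubPtolemyInterlacing
import Literature.Computation.FiniteGraph.SpinSums

/-!
# `Interlacing` (item stmt-CriticalPhenomena-15702): a MIRROR-SYMMETRIC 12-site region reverses the
# sub-Ptolemy inequality at strong coupling and satisfies it near `β_c(3)`

Negative knowledge about the crux
`Summit.CriticalPhenomena.Ising3DConformalLimit.Theses.SubPtolemyInterlacing.Interlacing`
(SPC: `S₄·P₂ ≤ P₁·P₃` on interlaced axis quadruples, `P₁ = G₁₂G₃₄` adjacent, `P₂ = G₁₃G₂₄` crossing,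
`P₃ = G₁₄G₂₃` nested), answering the line lead's request (crux `NOTES.md`, lead c2, "disprover-wanted":
a kernel-certified lemma that SPC(1,1,1) fails for free Ising on a MIRROR-SYMMETRIC finite subgraph of
`ℤ³` containing the axis quadruple, mirror = bisector plane of `[x₂,x₃]` / `[x₁,x₄]`, at a rational
`t = tanh β`), filed by crux triager r1-2 as evidence for the triage of the idea card
`mirror-fold-ghost-dictionary` (folded / reflected currents through a mirror orthogonal to the axis).
THEOREM-ONLY, no definitions, no named facts.

**The region.** `Λ_M ⊂ ℤ² × {0} ⊂ ℤ³` is the `4 × 3` grid `{0,1,2,3} × {-1,0,1}`: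

* axis `x₁ = (0,0)`, `x₂ = (1,0)`, `x₃ = (2,0)`, `x₄ = (3,0)` (gaps `(a,b,c) = (1,1,1)`) — labels `0,1,2,3`;
* the upper row `(0,1), (1,1), (2,1), (3,1)` — labels `4,5,6,7`;
* the lower row `(0,-1), (1,-1), (2,-1), (3,-1)` — labels `8,9,10,11`;

with its `17` nearest-neighbour bonds (induced subgraph of `ℤ³`; the same graph arises with the two
rows in the `e₂`- and the `e₃`-direction — a right-angled two-page book, genuinely three-dimensional).
`Λ_M` is symmetric under the reflection `x ↦ 3 - x` in the plane bisecting the middle gap `[x₂,x₃]`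
(equivalently `[x₁,x₄]`), which swaps `x₁ ↔ x₄`, `x₂ ↔ x₃`, AND under `y ↦ -y`; the quadruple lies on
the middle row, i.e. in the interior of this planar graph (no boundary-Pfaffian identity applies).

**Certificates** (exact rational arithmetic in the kernel through the tree's finite-graph witness engine
`Literature.Computation.FiniteGraph`, `decide +kernel`; values found and cross-checked off-line by the
triager's exact enumeration `toys/symsearch.py`, crux-triage folder):

* `tanh β = 3/5` (`β = artanh (3/5) = log 2 ≈ 0.693`): SPC(1,1,1) is REVERSED strictly,
  `ρ := S₄P₂/(P₁P₃) = 1 + 3.03·10⁻⁴` (`S₄ = 180393813/246685525`, `G₁₂ = G₃₄ = 8418147/9867421`,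
  `G₁₃ = G₂₄ = 190046421/246685525`, `G₁₄ = 835349463/1233427625`, `G₂₃ = 43428207/49337105`);
* `tanh β = 7/32` (`β = 0.2223`, within `10⁻³` of `β_c(3) = 0.22165`): SPC(1,1,1) HOLDS strictly,
  `ρ = 1 − 4.10·10⁻²`.

Off-line (same enumeration): `ρ < 1` for all sampled `t < t* ≈ 0.5719` and `ρ > 1` for `t ∈ (t*, 1)`
(`ρ − 1 = +1.49·10⁻⁴` at `t = 7/10`, `+1.03·10⁻⁵` at `4/5`, `+6.8·10⁻⁸` at `9/10`); among 2 829 connected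
mirror-symmetric regions with `≤ 17` sites built from an axis segment and mirror-orbits of decoration
sites (shapes `(1,1,1)`, `(1,2,1)`, `(2,2,2)`, `(2,1,3)`; site mirrors and the bond mirror) NONE violates
SPC at `t ∈ {1/10, 2183/10⁴, 3/10}` and the smallest violators at `t ≥ 3/5` are `Λ_M` and its
decorations — in contrast with the STAGGERED (mirror-asymmetric) 10-site region `Λ_Z` of
`RegionCounterexample.lean`, which violates SPC at every `t ∈ (0,1)` with `ρ − 1 = t⁴ + O(t⁶)`.

**What it says for the crux.** (i) The interlacing inequality is not a consequence of finite-graph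
identities PLUS a mirror symmetry of the graph through the bisector of the middle gap: any coupling /
injection of folded (reflected) currents that is valid on every finite graph carrying such a mirror, at
every `β`, would prove SPC on `Λ_M` at `β = log 2`, which is false (this is the finite, kernel-certified
form of the ideator's barrier note "B2" — thin supercritical cylinders `ℤ × (ℤ/W)²`, exact transfer
matrices — and of row 3 of the dead-line record `Lines/Sketch_dead.md`). (ii) On mirror-symmetric
graphs the failure needs STRONG coupling (here `t > 0.57`; on the cylinders, `β` above their crossover),
unlike on staggered regions: the mirror does carry lattice-scale information in favour of SPC, but a
proof on `ℤ³` at `β_c` must still use a quantitative input that distinguishes `β ≤ β_c(ℤ³)` from strong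
coupling — it cannot be a `β`-uniform combinatorial statement about mirror graphs.
-/

namespace Summit.CriticalPhenomena.Ising3DConformalLimit.InterlacingNegative

open Literature.Probability.LatticeModels Literature.Computation Finset

/-! Throughout, the 17 nearest-neighbour bonds of `Λ_M` (labels as in the module docstring) are
`{uM i, vM i}` with first endpoints `uM = ![0, 1, 2, 4, 5, 6, 8, 9, 10, 0, 1, 2, 3, 0, 1, 2, 3]` and second
endpoints `vM = ![1, 2, 3, 5, 6, 7, 9, 10, 11, 4, 5, 6, 7, 8, 9, 10, 11]` (axis `01,12,23`, upper row
`45,56,67`, lower row `89,9 10,10 11`, rungs `04,15,26,37` up and `08,19,2 10,3 11` down); every statement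
quantifies over `uM vM` pinned to these literals, so that no definition or notation is introduced. -/

/-! ### Kernel certificates (exact rationals) -/

/-- `tanh β = 3/5` (`β = log 2`): `P₁·P₃ < S₄·P₂` on the mirror-symmetric region `Λ_M` — SPC(1,1,1)
reversed. [folklore] -/
theorem isingExpect_mirrorRegion_interlacing_reversed_three_fifths (uM vM : Fin 17 → Fin 12)
    (hu : uM = ![0, 1, 2, 4, 5, 6, 8, 9, 10, 0, 1, 2, 3, 0, 1, 2, 3])
    (hv : vM = ![1, 2, 3, 5, 6, 7, 9, 10, 11, 4, 5, 6, 7, 8, 9, 10, 11]) :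
    FiniteGraph.isingExpect 12 (FiniteGraph.bondsOfFn uM vM (fun _ => 3) (fun _ => 5)) [0, 1] *
          FiniteGraph.isingExpect 12 (FiniteGraph.bondsOfFn uM vM (fun _ => 3) (fun _ => 5)) [2, 3] *
        (FiniteGraph.isingExpect 12 (FiniteGraph.bondsOfFn uM vM (fun _ => 3) (fun _ => 5)) [0, 3] *
          FiniteGraph.isingExpect 12 (FiniteGraph.bondsOfFn uM vM (fun _ => 3) (fun _ => 5)) [1, 2]) <
      FiniteGraph.isingExpect 12 (FiniteGraph.bondsOfFn uM vM (fun _ => 3) (fun _ => 5)) [0, 1, 2, 3] *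
        (FiniteGraph.isingExpect 12 (FiniteGraph.bondsOfFn uM vM (fun _ => 3) (fun _ => 5)) [0, 2] *
          FiniteGraph.isingExpect 12 (FiniteGraph.bondsOfFn uM vM (fun _ => 3) (fun _ => 5)) [1, 3]) := by
  subst hu hv
  decide +kernel

/-- `tanh β = 7/32` (`β = 0.2223 ≈ β_c(3)`): `S₄·P₂ < P₁·P₃` on `Λ_M` — SPC(1,1,1) holds strictly
(`ρ = 0.959`). [folklore] -/
theorem isingExpect_mirrorRegion_interlacing_holds_7_32 (uM vM : Fin 17 → Fin 12)
    (hu : uM = ![0, 1, 2, 4, 5, 6, 8, 9, 10, 0, 1, 2, 3, 0, 1, 2, 3])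
    (hv : vM = ![1, 2, 3, 5, 6, 7, 9, 10, 11, 4, 5, 6, 7, 8, 9, 10, 11]) :
    FiniteGraph.isingExpect 12 (FiniteGraph.bondsOfFn uM vM (fun _ => 7) (fun _ => 32)) [0, 1, 2, 3] *
        (FiniteGraph.isingExpect 12 (FiniteGraph.bondsOfFn uM vM (fun _ => 7) (fun _ => 32)) [0, 2] *
          FiniteGraph.isingExpect 12 (FiniteGraph.bondsOfFn uM vM (fun _ => 7) (fun _ => 32)) [1, 3]) <
      FiniteGraph.isingExpect 12 (FiniteGraph.bondsOfFn uM vM (fun _ => 7) (fun _ => 32)) [0, 1] *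
          FiniteGraph.isingExpect 12 (FiniteGraph.bondsOfFn uM vM (fun _ => 7) (fun _ => 32)) [2, 3] *
        (FiniteGraph.isingExpect 12 (FiniteGraph.bondsOfFn uM vM (fun _ => 7) (fun _ => 32)) [0, 3] *
          FiniteGraph.isingExpect 12 (FiniteGraph.bondsOfFn uM vM (fun _ => 7) (fun _ => 32)) [1, 2]) := by
  subst hu hv
  decide +kernel

/-! ### The Gibbs-measure statements -/

/-- **Transfer to the Gibbs expectation.** For the ferromagnetic pair interaction `K ≡ artanh (a/b)`
(`-b < a < b`) on the 17 bonds of `Λ_M`, a rational certificate for bond parameter `a/b` of the REVERSED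
interlacing inequality gives `⟨σ₁σ₂⟩⟨σ₃σ₄⟩·⟨σ₁σ₄⟩⟨σ₂σ₃⟩ < ⟨σ₁σ₂σ₃σ₄⟩·⟨σ₁σ₃⟩⟨σ₂σ₄⟩` for the tree's
expectation `gksExpect` (bridge `gksExpect_spinProduct_eq` of the finite-graph witness engine,
Friedli–Velenik 2017 §3.8.1 eq. (3.44)). [folklore] -/
theorem gksExpect_mirrorRegion_interlacing_reversed_of_cert (uM vM : Fin 17 → Fin 12)
    (hu : uM = ![0, 1, 2, 4, 5, 6, 8, 9, 10, 0, 1, 2, 3, 0, 1, 2, 3])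
    (hv : vM = ![1, 2, 3, 5, 6, 7, 9, 10, 11, 4, 5, 6, 7, 8, 9, 10, 11])
    {a : ℤ} {b : ℕ} (h₁ : -(b : ℤ) < a) (h₂ : a < b)
    (hcert :
      FiniteGraph.isingExpect 12 (FiniteGraph.bondsOfFn uM vM (fun _ => a) (fun _ => b)) [0, 1] *
            FiniteGraph.isingExpect 12 (FiniteGraph.bondsOfFn uM vM (fun _ => a) (fun _ => b)) [2, 3] *
          (FiniteGraph.isingExpect 12 (FiniteGraph.bondsOfFn uM vM (fun _ => a) (fun _ => b)) [0, 3] *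
            FiniteGraph.isingExpect 12 (FiniteGraph.bondsOfFn uM vM (fun _ => a) (fun _ => b)) [1, 2]) <
        FiniteGraph.isingExpect 12 (FiniteGraph.bondsOfFn uM vM (fun _ => a) (fun _ => b)) [0, 1, 2, 3] *
          (FiniteGraph.isingExpect 12 (FiniteGraph.bondsOfFn uM vM (fun _ => a) (fun _ => b)) [0, 2] *
            FiniteGraph.isingExpect 12 (FiniteGraph.bondsOfFn uM vM (fun _ => a) (fun _ => b)) [1, 3]))
    (K : Fin 17 → ℝ) (hK : ∀ i, K i = Real.artanh ((a : ℝ) / (b : ℝ))) :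
    gksExpect univ K (fun i => ({uM i, vM i} : Finset (Fin 12))) (fun ω => spinAt 0 ω * spinAt 1 ω) *
          gksExpect univ K (fun i => ({uM i, vM i} : Finset (Fin 12))) (fun ω => spinAt 2 ω * spinAt 3 ω) *
        (gksExpect univ K (fun i => ({uM i, vM i} : Finset (Fin 12))) (fun ω => spinAt 0 ω * spinAt 3 ω) *
          gksExpect univ K (fun i => ({uM i, vM i} : Finset (Fin 12))) (fun ω => spinAt 1 ω * spinAt 2 ω)) <
      gksExpect univ K (fun i => ({uM i, vM i} : Finset (Fin 12)))
          (spinProduct ({0, 1, 2, 3} : Finset (Fin 12))) *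
        (gksExpect univ K (fun i => ({uM i, vM i} : Finset (Fin 12))) (fun ω => spinAt 0 ω * spinAt 2 ω) *
          gksExpect univ K (fun i => ({uM i, vM i} : Finset (Fin 12))) (fun ω => spinAt 1 ω * spinAt 3 ω)) := by
  have huv : ∀ i : Fin 17, uM i ≠ vM i := by subst hu hv; decide
  have hb0 : ∀ i : Fin 17, (fun _ : Fin 17 => b) i ≠ 0 := fun _ => by
    simp only [ne_eq]
    omega
  have ht : ∀ i : Fin 17, Real.tanh (K i) =
      ((fun _ : Fin 17 => a) i : ℝ) / ((fun _ : Fin 17 => b) i : ℝ) := by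
    intro i
    rw [hK i]
    exact FiniteGraph.tanh_artanh_div h₁ h₂
  have hC : ∀ i : Fin 17, (fun i => ({uM i, vM i} : Finset (Fin 12))) i = {uM i, vM i} := fun _ => rfl
  rw [FiniteGraph.gksExpect_spinAt_mul_spinAt_eq K _ uM vM _ _ hC huv hb0 ht 0 1,
    FiniteGraph.gksExpect_spinAt_mul_spinAt_eq K _ uM vM _ _ hC huv hb0 ht 2 3,
    FiniteGraph.gksExpect_spinAt_mul_spinAt_eq K _ uM vM _ _ hC huv hb0 ht 0 3,
    FiniteGraph.gksExpect_spinAt_mul_spinAt_eq K _ uM vM _ _ hC huv hb0 ht 1 2,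
    FiniteGraph.gksExpect_spinAt_mul_spinAt_eq K _ uM vM _ _ hC huv hb0 ht 0 2,
    FiniteGraph.gksExpect_spinAt_mul_spinAt_eq K _ uM vM _ _ hC huv hb0 ht 1 3,
    FiniteGraph.gksExpect_spinProduct_eq K _ uM vM _ _ hC huv hb0 ht {0, 1, 2, 3} [0, 1, 2, 3]
      (by decide) (by decide)]
  have e0 : ((0 : Fin 12) : ℕ) = 0 := rfl
  have e1 : ((1 : Fin 12) : ℕ) = 1 := rfl
  have e2 : ((2 : Fin 12) : ℕ) = 2 := rfl
  have e3 : ((3 : Fin 12) : ℕ) = 3 := rfl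
  simp only [List.map_cons, List.map_nil, e0, e1, e2, e3]
  exact_mod_cast hcert

/-- **The interlacing inequality fails for the free-boundary Ising model on the mirror-symmetric region
`Λ_M = {0,1,2,3} × {-1,0,1} ⊂ ℤ³` at `β = artanh (3/5) = log 2`** (ferromagnetic n.n. coupling `K ≡ β`
on the 17 bonds; axis quadruple `x₁ = 0, x₂ = e₁, x₃ = 2e₁, x₄ = 3e₁`, all four the images of one another
under the mirror `x ↦ 3 - x` of `Λ_M`): `⟨σ₁σ₂⟩⟨σ₃σ₄⟩·⟨σ₁σ₄⟩⟨σ₂σ₃⟩ < ⟨σ₁σ₂σ₃σ₄⟩·⟨σ₁σ₃⟩⟨σ₂σ₄⟩`. [folklore] -/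
theorem gksExpect_mirrorRegion_interlacing_reversed (uM vM : Fin 17 → Fin 12)
    (hu : uM = ![0, 1, 2, 4, 5, 6, 8, 9, 10, 0, 1, 2, 3, 0, 1, 2, 3])
    (hv : vM = ![1, 2, 3, 5, 6, 7, 9, 10, 11, 4, 5, 6, 7, 8, 9, 10, 11]) (K : Fin 17 → ℝ)
    (hK : ∀ i, K i = Real.artanh (3 / 5)) :
    gksExpect univ K (fun i => ({uM i, vM i} : Finset (Fin 12))) (fun ω => spinAt 0 ω * spinAt 1 ω) *
          gksExpect univ K (fun i => ({uM i, vM i} : Finset (Fin 12))) (fun ω => spinAt 2 ω * spinAt 3 ω) *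
        (gksExpect univ K (fun i => ({uM i, vM i} : Finset (Fin 12))) (fun ω => spinAt 0 ω * spinAt 3 ω) *
          gksExpect univ K (fun i => ({uM i, vM i} : Finset (Fin 12))) (fun ω => spinAt 1 ω * spinAt 2 ω)) <
      gksExpect univ K (fun i => ({uM i, vM i} : Finset (Fin 12)))
          (spinProduct ({0, 1, 2, 3} : Finset (Fin 12))) *
        (gksExpect univ K (fun i => ({uM i, vM i} : Finset (Fin 12))) (fun ω => spinAt 0 ω * spinAt 2 ω) *
          gksExpect univ K (fun i => ({uM i, vM i} : Finset (Fin 12))) (fun ω => spinAt 1 ω * spinAt 3 ω)) :=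
  gksExpect_mirrorRegion_interlacing_reversed_of_cert uM vM hu hv (a := 3) (b := 5) (by norm_num)
    (by norm_num) (isingExpect_mirrorRegion_interlacing_reversed_three_fifths uM vM hu hv) K
    (fun i => by rw [hK i]; norm_num)

/-- In the bracket shape of the crux: `S₄·(G₁₃G₂₄) ≤ G₁₂G₃₄·(G₁₄G₂₃)` is FALSE for the free-boundary
Ising model on the mirror-symmetric region `Λ_M` at `β = artanh (3/5)`. Hence no mirror-based coupling
of folded currents that is valid on every finite graph with a mirror through the bisector of the middle
gap, uniformly in `β`, can prove the crux or its box form `stub_engine`. [folklore] -/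
theorem not_interlacing_mirrorRegion (uM vM : Fin 17 → Fin 12)
    (hu : uM = ![0, 1, 2, 4, 5, 6, 8, 9, 10, 0, 1, 2, 3, 0, 1, 2, 3])
    (hv : vM = ![1, 2, 3, 5, 6, 7, 9, 10, 11, 4, 5, 6, 7, 8, 9, 10, 11]) (K : Fin 17 → ℝ)
    (hK : ∀ i, K i = Real.artanh (3 / 5)) :
    ¬ gksExpect univ K (fun i => ({uM i, vM i} : Finset (Fin 12)))
          (spinProduct ({0, 1, 2, 3} : Finset (Fin 12))) *
        (gksExpect univ K (fun i => ({uM i, vM i} : Finset (Fin 12))) (fun ω => spinAt 0 ω * spinAt 2 ω) *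
          gksExpect univ K (fun i => ({uM i, vM i} : Finset (Fin 12))) (fun ω => spinAt 1 ω * spinAt 3 ω)) ≤
      gksExpect univ K (fun i => ({uM i, vM i} : Finset (Fin 12))) (fun ω => spinAt 0 ω * spinAt 1 ω) *
          gksExpect univ K (fun i => ({uM i, vM i} : Finset (Fin 12))) (fun ω => spinAt 2 ω * spinAt 3 ω) *
        (gksExpect univ K (fun i => ({uM i, vM i} : Finset (Fin 12))) (fun ω => spinAt 0 ω * spinAt 3 ω) *
          gksExpect univ K (fun i => ({uM i, vM i} : Finset (Fin 12))) (fun ω => spinAt 1 ω * spinAt 2 ω)) :=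
  not_le.mpr (gksExpect_mirrorRegion_interlacing_reversed uM vM hu hv K hK)

/-- The witness coupling is ferromagnetic and strong: `0 < artanh (3/5)` (`= log 2 ≈ 0.693 > β_c(3)`).
[folklore] -/
theorem artanh_three_fifths_pos : 0 < Real.artanh (3 / 5) :=
  Real.artanh_pos (x := 3 / 5) ⟨by norm_num, by norm_num⟩

end Summit.CriticalPhenomena.Ising3DConformalLimit.InterlacingNegative
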